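import Literature.AlgebraicGeometry.HodgeTheory.HyperplaneSectionMonodromySmoothLocus
import Literature.AlgebraicGeometry.Motives.UniversalHyperplaneSectionSmoothNear
import Literature.AlgebraicGeometry.Motives.VarietiesGeometricallyIntegralProofs
import HarnessLib

/-!
# The monodromy package of the universal hyperplane section: the named fact holds

Family `hodge`, layer `Literature/AlgebraicGeometry/HodgeTheory`. Discharge of the named fact
`nonempty_universalHyperplaneSectionLocalSystem` of `HodgeTheory/HyperplaneSectionMonodromy`
(Voisin II §3.2.2–§3.2.3 and §2.3.1, Voisin I Thm. 9.3): for a smooth projective complex variety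
`X ⊆ ℙᴺ` of dimension `n + 1`, the locus `U ⊆ (ℙᴺ)^*(ℂ)` of smooth `n`-dimensional hyperplane
sections is open and carries the local system `Hⁿ(X_t, ℚ)_van` with its monodromy representation and
its `π₁`-equivariance package (`UniversalHyperplaneSectionLocalSystem N ι n` is inhabited).

The proof follows Voisin: `π : 𝒳_U → U` is a smooth proper morphism, hence (Ehresmann, Voisin I
Thm. 9.3) a locally trivial fibration on complex points, so `R^k π_* ℚ` is a local system. In the
tree this is assembled from

* `HyperplaneSectionMonodromyProofs` / `…Trivialisations` — the topological half (covering space of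
  `Hⁿ` of the fibres from local trivialisations, transport, Gysin coherence);
* `Motives/ComplexPointsEhresmann` — Ehresmann's theorem on complex points of a smooth proper
  morphism of smooth `ℂ`-schemes;
* `HyperplaneSectionMonodromySmoothLocus` — reduction to: `π` is smooth of relative dimension `n`
  over a Zariski neighbourhood of every `t ∈ U` (openness of `U` included);
* `Motives/UniversalHyperplaneSectionSmoothNear` — that statement (Jacobian criterion on the charts
  of the incidence variety, Voisin II §2.1.1, Hartshorne III Prop. 10.4), applied here to the smooth
  fibre `X_t` of a point `t ∈ U` (`X` is reduced, being smooth over `ℂ`).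

## References

* [VoisinHodgeII2003] C. Voisin, Hodge Theory and Complex Algebraic Geometry II, CUP 2003, §3.2.2,
  §3.2.3, §2.3.1.
* [VoisinHodgeI2002] C. Voisin, Hodge Theory and Complex Algebraic Geometry I, CUP 2002, Thm. 9.3,
  §9.2.1.
-/

noncomputable section

open CategoryTheory AlgebraicGeometry Limits

namespace Literature.AlgebraicGeometry.HodgeTheory

/-- **The monodromy package of the universal hyperplane section exists** (discharge of the named
fact `nonempty_universalHyperplaneSectionLocalSystem`, Voisin II §3.2.2–§3.2.3, §2.3.1; Voisin I
Thm. 9.3): for a smooth projective `X ⊆ ℙᴺ_ℂ` of dimension `n + 1`, the locus `U ⊆ (ℙᴺ)^*(ℂ)` of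
smooth `n`-dimensional hyperplane sections is open and the vanishing-cohomology local system
`H^n(X_t, ℚ)_van` over `U` with its monodromy representation and `π₁`-equivariance package exists.
Assembly: `π : 𝒳 ⟶ (ℙᴺ)^*` is smooth of relative dimension `n` over a Zariski neighbourhood of every
point of `U` (`Motives/UniversalHyperplaneSectionSmoothNear`, the Jacobian criterion on the charts
of the incidence variety), hence (`HyperplaneSectionMonodromySmoothLocus`: Ehresmann's theorem on
complex points, openness of `U`, the covering space of `Hⁿ` and its transport) the package.
[cite: VoisinHodgeII2003, §3.2.2, §3.2.3, §2.3.1] [cite: VoisinHodgeI2002, Thm. 9.3, §9.2.1] -/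
theorem nonempty_universalHyperplaneSectionLocalSystem_holds : nonempty_universalHyperplaneSectionLocalSystem := by
  intro N n X hX ι hι
  haveI := hX.smoothOfRelativeDimension
  haveI : Smooth X.hom := SmoothOfRelativeDimension.smooth (n + 1) X.hom
  haveI : IsReduced X.left := Motives.isReduced_of_smooth_over_field X.hom
  haveI : IsProper X.hom := Motives.IsSmoothProjective.isProper_holds hX
  haveI : IsClosedImmersion ι.left := hι
  refine nonempty_universalHyperplaneSectionLocalSystem_of_smoothOfRelativeDimension_morphismRestrict
    N n hX ι fun t ht ↦ ?_
  have ht' : Motives.IsSmoothProjective n (Motives.fiberOver (Motives.UniversalHyperplaneSection.proj N ι) t) := ht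
  have hfib : SmoothOfRelativeDimension n
      (pullback.snd (Motives.UniversalHyperplaneSection.proj N ι).left t.left) := by
    haveI := Motives.isIso_specOver_self_hom (k := ℂ)
    have h := ht'.smoothOfRelativeDimension
    rw [Motives.fiberOver_hom] at h
    exact (MorphismProperty.cancel_right_of_respectsIso (@SmoothOfRelativeDimension n) _ _).1 h
  exact Motives.UniversalHyperplaneSection.exists_smoothOfRelativeDimension_morphismRestrict_of_fibre ι n t hfib

end Literature.AlgebraicGeometry.HodgeTheory

end
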